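import Mathlib
import Literature.Probability.LatticeModels.GKSInequalities
import HarnessLib

/-!
# Crux `PrecisionLaplacian.InverseMFerromagnet` (stmt-CriticalPhenomena-4798), line `Sketch` —
# stub `stub_im_of_sp` (core E, E3: the deletion–contraction induction)

THEOREM-ONLY file (no definitions).  The crux IM says that every off-diagonal entry of the inverse
spin second-moment matrix `Σ⁻¹` of a finite zero-field pair ferromagnet (`gksExpect univ K C`,
`K ≥ 0`, `|C i| = 2`) is `≤ 0`.  This file proves the purely combinatorial induction step E3 of the
deletion–contraction pencil: from

* SP (E1, a hypothesis here): for a bond pair `u ≠ v` and a pair `p ≠ q` disjoint from `{u,v}`, the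
  `(p,q)` entry is `≤ 0` as soon as it is `≤ 0` in the DELETED system (all couplings of bonds supported
  on `{u,v}` set to `0`, same supports) and in the CONTRACTED system (same zeroed couplings; the bonds
  equal to `{u,v}` re-supported on the dummy pair `{p,q}`, every other bond with `v` replaced by `u`);
* the hub-pair base case (E2, a hypothesis here): if every bond with a nonzero coupling contains `p`
  or `q`, the `(p,q)` entry is `≤ 0`;

we get IM for all systems, by induction on the number of nonzero couplings with `n, m` fixed: for a
pair `x ≠ y` either every nonzero bond meets `{x,y}` (E2), or some bond `C i₀ = {u,v}` with `K i₀ ≠ 0`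
avoids both, and E1 applies; both the deleted and the contracted system have the coupling vector
`K⁰ i = if C i = {u,v} then 0 else K i`, which has strictly fewer nonzero entries (`K⁰ i₀ = 0`), and the
contracted supports are again pairs.  The matrix expression is never unfolded.
-/

namespace Summit.CriticalPhenomena.Ising3DConformalLimit.Cruxes.InverseMFerromagnet.PartialCovarianceLadder

open Literature.Probability.LatticeModels Finset Matrix

noncomputable section

/-- Deletion keeps the couplings nonnegative: `0 ≤ K⁰ i` for `K⁰ i = if C i = {u,v} then 0 else K i`.
[folklore] -/
theorem csp_nonneg_delete {n m : ℕ} (K : Fin m → ℝ) (C : Fin m → Finset (Fin n)) (u v : Fin n)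
    (hK : ∀ i, 0 ≤ K i) : ∀ i, 0 ≤ (if C i = {u, v} then (0 : ℝ) else K i) := by
  intro i
  split_ifs
  · exact le_rfl
  · exact hK i

/-- The cardinality drop of the induction: if `K i₀ ≠ 0` and `C i₀ = {u,v}`, the deleted coupling vector
`K⁰ i = if C i = {u,v} then 0 else K i` has strictly fewer nonzero entries than `K`. [folklore] -/
theorem csp_card_filter_lt {n m : ℕ} (K : Fin m → ℝ) (C : Fin m → Finset (Fin n)) (u v : Fin n)
    (i₀ : Fin m) (hKi : K i₀ ≠ 0) (hCi : C i₀ = {u, v}) :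
    (Finset.univ.filter (fun i => (if C i = {u, v} then (0 : ℝ) else K i) ≠ 0)).card <
      (Finset.univ.filter (fun i => K i ≠ 0)).card := by
  apply Finset.card_lt_card
  refine (Finset.ssubset_iff_of_subset ?_).mpr ⟨i₀, ?_, ?_⟩
  · intro i hi
    simp only [Finset.mem_filter, Finset.mem_univ, true_and] at hi ⊢
    intro h0
    apply hi
    rw [h0, ite_self]
  · exact Finset.mem_filter.mpr ⟨Finset.mem_univ _, hKi⟩
  · intro hmem
    exact (Finset.mem_filter.mp hmem).2 (if_pos hCi)

/-- The contraction map `z ↦ if z = v then u else z` is injective on every pair `{a,b} ≠ {u,v}`.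
[folklore] -/
theorem csp_contract_ne {n : ℕ} (a b u v : Fin n) (hab : a ≠ b)
    (h : ({a, b} : Finset (Fin n)) ≠ {u, v}) :
    (if a = v then u else a) ≠ (if b = v then u else b) := by
  intro hf
  by_cases ha : a = v <;> by_cases hb : b = v
  · exact hab (ha.trans hb.symm)
  · rw [if_pos ha, if_neg hb] at hf
    apply h
    rw [ha, ← hf, Finset.pair_comm]
  · rw [if_neg ha, if_pos hb] at hf
    apply h
    rw [hb, hf]
  · rw [if_neg ha, if_neg hb] at hf
    exact hab hf

/-- The contracted supports are again pairs: the bonds equal to `{u,v}` are re-supported on the pair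
`{x,y}` (`x ≠ y`), every other pair support `{a,b}` is mapped to the pair `{f a, f b}`,
`f z = if z = v then u else z`, which has two elements by `csp_contract_ne`. [folklore] -/
theorem csp_card_contract {n m : ℕ} (C : Fin m → Finset (Fin n)) (u v x y : Fin n)
    (hC : ∀ i, (C i).card = 2) (hxy : x ≠ y) :
    ∀ i, (if C i = {u, v} then ({x, y} : Finset (Fin n))
      else (C i).image (fun z => if z = v then u else z)).card = 2 := by
  intro i
  split_ifs with h
  · exact Finset.card_pair hxy
  · obtain ⟨a, b, hab, hCi⟩ := Finset.card_eq_two.mp (hC i)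
    rw [hCi] at h ⊢
    rw [Finset.image_insert, Finset.image_singleton]
    exact Finset.card_pair (csp_contract_ne a b u v hab h)

/-- **E3 · the deletion–contraction induction (finite).**  SP (E1) and the hub-pair base case (E2) give IM, by
strong induction on the number of nonzero couplings with `n, m` fixed: for a pair `x ≠ y` either every nonzero
bond meets `{x,y}` (E2), or some bond `{u,v}` with `K ≠ 0` avoids both, and E1 applies to the deleted system
(couplings on `{u,v}` zeroed: fewer nonzero couplings) and to the contracted system (same couplings, bonds at `v`
moved to `u`, zeroed bonds re-supported on `{x,y}`: pair supports, fewer nonzero couplings). [folklore] -/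
theorem stub_im_of_sp :
    (∀ (n m : ℕ) (K : Fin m → ℝ) (C : Fin m → Finset (Fin n)), (∀ i, 0 ≤ K i) → (∀ i, (C i).card = 2) →
      ∀ (u v p q : Fin n), u ≠ v → p ≠ q → p ≠ u → p ≠ v → q ≠ u → q ≠ v →
        (Matrix.of fun a b : Fin n =>
            gksExpect Finset.univ (fun i => if C i = {u, v} then 0 else K i) C
              (fun ω => spinAt a ω * spinAt b ω))⁻¹ p q ≤ 0 →
        (Matrix.of fun a b : Fin n =>
            gksExpect Finset.univ (fun i => if C i = {u, v} then 0 else K i)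
              (fun i => if C i = {u, v} then ({p, q} : Finset (Fin n))
                else (C i).image (fun z => if z = v then u else z))
              (fun ω => spinAt a ω * spinAt b ω))⁻¹ p q ≤ 0 →
        (Matrix.of fun a b : Fin n => gksExpect Finset.univ K C (fun ω => spinAt a ω * spinAt b ω))⁻¹ p q ≤ 0) →
    (∀ (n m : ℕ) (K : Fin m → ℝ) (C : Fin m → Finset (Fin n)), (∀ i, 0 ≤ K i) → (∀ i, (C i).card = 2) →
      ∀ (p q : Fin n), p ≠ q → (∀ i, K i ≠ 0 → p ∈ C i ∨ q ∈ C i) →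
        (Matrix.of fun a b : Fin n => gksExpect Finset.univ K C (fun ω => spinAt a ω * spinAt b ω))⁻¹ p q ≤ 0) →
    ∀ (n m : ℕ) (K : Fin m → ℝ) (C : Fin m → Finset (Fin n)), (∀ i, 0 ≤ K i) → (∀ i, (C i).card = 2) →
      ∀ x y : Fin n, x ≠ y →
        (Matrix.of fun p q : Fin n => gksExpect Finset.univ K C (fun ω => spinAt p ω * spinAt q ω))⁻¹ x y ≤ 0 := by
  intro hSP hHub n m
  -- Induction on an upper bound `k` for the number of nonzero couplings, with `n, m` fixed.
  suffices haux : ∀ (k : ℕ) (K : Fin m → ℝ) (C : Fin m → Finset (Fin n)),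
      (Finset.univ.filter (fun i => K i ≠ 0)).card ≤ k → (∀ i, 0 ≤ K i) → (∀ i, (C i).card = 2) →
      ∀ x y : Fin n, x ≠ y →
        (Matrix.of fun p q : Fin n =>
          gksExpect Finset.univ K C (fun ω => spinAt p ω * spinAt q ω))⁻¹ x y ≤ 0 by
    intro K C hK hC x y hxy
    exact haux _ K C le_rfl hK hC x y hxy
  intro k
  induction k with
  | zero =>
    -- no nonzero coupling at all: the hub-pair hypothesis holds vacuously
    intro K C hk hK hC x y hxy
    refine hHub n m K C hK hC x y hxy fun i hi => ?_
    exfalso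
    have hmem : i ∈ Finset.univ.filter (fun i => K i ≠ 0) :=
      Finset.mem_filter.mpr ⟨Finset.mem_univ _, hi⟩
    rw [Finset.card_eq_zero.mp (Nat.le_zero.mp hk)] at hmem
    exact Finset.notMem_empty _ hmem
  | succ k ih =>
    intro K C hk hK hC x y hxy
    by_cases hhub : ∀ i, K i ≠ 0 → x ∈ C i ∨ y ∈ C i
    · exact hHub n m K C hK hC x y hxy hhub
    -- a bond `C i₀ = {u, v}` with nonzero coupling avoiding both `x` and `y`
    push Not at hhub
    obtain ⟨i₀, hKi₀, hxi₀, hyi₀⟩ := hhub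
    obtain ⟨u, v, huv, hCi₀⟩ := Finset.card_eq_two.mp (hC i₀)
    rw [hCi₀] at hxi₀ hyi₀
    simp only [Finset.mem_insert, Finset.mem_singleton, not_or] at hxi₀ hyi₀
    -- the deleted coupling vector has at most `k` nonzero entries
    have hle : (Finset.univ.filter
        (fun i => (if C i = {u, v} then (0 : ℝ) else K i) ≠ 0)).card ≤ k :=
      Nat.le_of_lt_succ ((csp_card_filter_lt K C u v i₀ hKi₀ hCi₀).trans_le hk)
    refine hSP n m K C hK hC u v x y huv hxy hxi₀.1 hxi₀.2 hyi₀.1 hyi₀.2 ?_ ?_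
    · -- deletion
      exact ih (fun i => if C i = {u, v} then 0 else K i) C hle (csp_nonneg_delete K C u v hK) hC
        x y hxy
    · -- contraction
      exact ih (fun i => if C i = {u, v} then 0 else K i)
        (fun i => if C i = {u, v} then ({x, y} : Finset (Fin n))
          else (C i).image (fun z => if z = v then u else z))
        hle (csp_nonneg_delete K C u v hK) (csp_card_contract C u v x y hC hxy) x y hxy

end

end Summit.CriticalPhenomena.Ising3DConformalLimit.Cruxes.InverseMFerromagnet.PartialCovarianceLadder
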